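import Literature.NumberTheory.GaloisRepresentations.GalLayerSystemLayers
import Literature.Algebra.Homology.DiscreteRepSubgroupLayers
import HarnessLib

/-!
# Relative layers of a Galois layer system: for an open subgroup `U ≤ Γ_F`, the layers of
# `(U, Res_U lim S)` are `(H_E ≤ Gal(E/F), Res_{H_E} S.obj E)`, `H_E` the image of `U`, and door-c4's
# transitions are the inflations restricted to these subgroups (Serre, *Galois Cohomology* I §2.2 Prop. 8;
# Harari §4.3 (2)–(3); Tate, C–F VII §11.1)

Topic `NumberTheory/GaloisRepresentations`; namespaces `Literature.NumberTheory.GaloisRepresentations.IdeleClassBar.GalLayer`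
(the image subgroups) and `Literature.NumberTheory.GaloisRepresentations.GalLayerData` (the layers).  Sequel to
`GalLayerSystemLayers.lean` (door-c5 g16: `GalLayerData F`, `D.layerRep`, `D.layerEquiv`, `D.layerCohomologyIso`,
`D.inf`, `map_invariantsStepIncl_comp_layerCohomologyIso` — the case `U = Γ_F`) and to
`Algebra/Homology/DiscreteRepSubgroupLayers.lean` (door-c6 g15: the trace `V ∩ U` of an open normal `V ≤ Γ` on `U`,
cofinality, the vanishing transfer `ext_res_eq_zero_of_forall_trace`).  Definitions with bodies and theorems; NO named
fact, no `sorry`, no instance, no notation.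

THE POINT.  Door-c4's Tate duality theorem (`DiscreteRepTateDuality.TateDualityHypotheses`, Milne ADT I Thm. 1.8) needs
the class-formation data of `C̄ = lim→ C_E` at EVERY open (normal) subgroup `U ≤ Γ_F`, i.e. statements about
`Extⁿ_{C_U}(ℤ, Res_U C̄)`.  By the previous file these are read on the trace layers `Hⁿ(U ⧸ (U_E ∩ U), (Res_U C̄)^{U_E ∩ U})`,
`U_E = Gal(F̄/E) ≤ U`; here such a layer is identified with the cohomology of the SUBGROUP
`H_E = {σ|_E : σ ∈ U} ≤ Gal(E/F)` with coefficients in the layer module `D.obj E` of the system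
(for `U = Gal(F̄/L)`, `H_E = Gal(E/L)`): `U ⧸ (U_E ∩ U) ≃* H_E` (`subgroupImageEquiv`, first isomorphism theorem for
`u ↦ u|_E`), `(Res_U lim S)^{U_E ∩ U} ≃ₗ D.V E` (`relLayerEquiv`: same vectors as `(lim S)^{U_E}`, then door-c5's
`layerEquiv`), equivariantly (`relLayerEquiv_comm`), whence
**`relLayerCohomologyIso : Hⁿ(U ⧸ (U_E ∩ U), (Res_U lim S)^{U_E ∩ U}) ≅ Hⁿ(H_E, Res_{H_E} D.obj E)`** (Mathlib
`groupCohomology.mapIso`); and for `E ≤ E'` door-c4's transition `stepG` for the group `U` is the RELATIVE INFLATION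
`D.relInf U h n = Hⁿ(res : H_{E'} → H_E, D.base h)` (`stepG_comp_relLayerCohomologyIso`), which commutes with the
restrictions from the full groups (`res_comp_relInf`: `res_{H_E} ≫ relInf = D.inf ≫ res_{H_{E'}}`).  This is the
currency in which the cell's finite-layer theorems AT SUBGROUPS (class-module axioms `H¹(H, Res C_E) = 0`, Tate's
theorem `H³(H, Res C_E) = 0`, the Tate–Nakayama tower vanishing) become statements about `Extⁿ_{C_U}(ℤ, Res_U C̄)`
(sequel `IdeleClassBarSubgroupVanishing.lean`).

## What is formalised (`F : Type` a field, `Γ = absoluteGaloisGroup F`, `U : Subgroup Γ`, `E E' : GalLayer F`)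

* §7 `GalLayer.subgroupImage U E = U.map E.restrictHom ≤ Gal(E/F)` (`H_E`), `toSubgroupImage` (`u ↦ u|_E`, onto),
  `restrictHom_eq_one_iff`, `ker_toSubgroupImage` (`= U_E ∩ U`, the trace), **`subgroupImageEquiv U E :
  U ⧸ (U_E ∩ U) ≃* H_E`** (+ `_mk`), `subgroupImageRes U h : H_{E'} →* H_E` (+ `coe_…_apply`, `…_toSubgroupImage`,
  `subtype_comp_subgroupImageRes`).
* §8 (`D : GalLayerData F`, `U_E ≤ U`) `D.relLayerRep U E` (door-c4's layer object for the group `U`),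
  `relToLayer` (same vectors as `D.layerRep E`), **`D.relLayerEquiv U E h : (Res_U lim S)^{U_E ∩ U} ≃ₗ[ℤ] D.V E`**
  (+ `_eq_iff`, `_ρ_mk`, **`relLayerEquiv_comm`**), **`D.relLayerCohomologyIso U E h n`**.
* §9 `D.relBaseRepHom U h`, **`D.relInf U h n : Hⁿ(H_E, Res D.obj E) ⟶ Hⁿ(H_{E'}, Res D.obj E')`**,
  **`res_comp_relInf`**, **`stepG_comp_relLayerCohomologyIso`** (`stepG ≫ iso_{E'} = iso_E ≫ relInf`),
  `relLayerEquiv_invariantsStepIncl`.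

Written for Route A of the Poitou–Tate programme of crux `AnticycControlAdditiveK` (cell bsd-schneider, item 19295),
seat door-c6 gen 15.  HONEST FRAMING: Galois-module bookkeeping only; no arithmetic statement and no case of BSD is
proved here.

## References
* J.-P. Serre, *Galois Cohomology*, Springer (1997), I §2.2 Proposition 8. [SerreGaloisCohomology1997]
* D. Harari, *Galois Cohomology and Class Field Theory* (2020), §4.3 (2)–(3), §13.1. [Harari2020]
* J. W. S. Cassels, A. Fröhlich (eds.), *Algebraic Number Theory* (1967), Ch. VII (J. Tate) §11.1. [CasselsFrohlichANT1967]
-/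

noncomputable section

open CategoryTheory groupCohomology
open Field (absoluteGaloisGroup)
open Literature.Algebra.Homology
open scoped Classical

namespace Literature.NumberTheory.GaloisRepresentations

namespace IdeleClassBar

namespace GalLayer

variable {F : Type} [Field F]

/-! ## §7. The image `H_E` of a subgroup `U ≤ Γ_F` in `Gal(E/F)` and `U ⧸ (U_E ∩ U) ≃* H_E` -/

/-- **`H_E = {σ|_E : σ ∈ U} ≤ Gal(E/F)`**, the image of a subgroup `U ≤ Γ_F` in the finite layer `Gal(E/F)` (for
`U = Gal(F̄/L)`, `L ≤ E`, this is `Gal(E/L)`). [cite: SerreGaloisCohomology1997, I §2.2 Proposition 8] -/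
abbrev subgroupImage (U : Subgroup (absoluteGaloisGroup F)) (E : GalLayer F) : Subgroup (E.1 ≃ₐ[F] E.1) :=
  U.map E.restrictHom

/-- `u ↦ u|_E : U → H_E`. [cite: SerreGaloisCohomology1997, I §2.2 Proposition 8] -/
def toSubgroupImage (U : Subgroup (absoluteGaloisGroup F)) (E : GalLayer F) : U →* subgroupImage U E :=
  (E.restrictHom.comp U.subtype).codRestrict _ fun u => Subgroup.mem_map_of_mem E.restrictHom u.2

/-- Formula. [cite: SerreGaloisCohomology1997, I §2.2 Proposition 8] -/
@[simp]
theorem coe_toSubgroupImage_apply (U : Subgroup (absoluteGaloisGroup F)) (E : GalLayer F) (u : U) :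
    ((toSubgroupImage U E u : subgroupImage U E) : E.1 ≃ₐ[F] E.1) = E.restrictHom u := rfl

/-- `u ↦ u|_E : U → H_E` is onto. [cite: SerreGaloisCohomology1997, I §2.2 Proposition 8] -/
theorem toSubgroupImage_surjective (U : Subgroup (absoluteGaloisGroup F)) (E : GalLayer F) :
    Function.Surjective (toSubgroupImage U E) := by
  rintro ⟨τ, hτ⟩
  obtain ⟨σ, hσ, rfl⟩ := Subgroup.mem_map.1 hτ
  exact ⟨⟨σ, hσ⟩, Subtype.ext rfl⟩

/-- `σ|_E = 1 ↔ σ ∈ U_E = Gal(F̄/E)` (Mathlib `IntermediateField.restrictNormalHom_ker`).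
[cite: SerreGaloisCohomology1997, I §2.2] -/
theorem restrictHom_eq_one_iff (E : GalLayer F) (σ : absoluteGaloisGroup F) :
    E.restrictHom σ = 1 ↔ σ ∈ (E.openNormalSubgroup : Subgroup (absoluteGaloisGroup F)) := by
  haveI := E.isGalois
  refine ⟨fun h => ?_, fun h => E.restrictHom_eq_one_of_mem h⟩
  have hker : σ ∈ (AlgEquiv.restrictNormalHom (F := F) (K₁ := AlgebraicClosure F) E.1).ker := h
  rw [IntermediateField.restrictNormalHom_ker] at hker
  exact hker

/-- **The kernel of `u ↦ u|_E` on `U` is the trace `U_E ∩ U`.** [cite: SerreGaloisCohomology1997, I §2.2 Proposition 8] -/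
theorem ker_toSubgroupImage (U : Subgroup (absoluteGaloisGroup F)) (E : GalLayer F) :
    (toSubgroupImage U E).ker =
      (DiscreteRep.traceOpenNormalSubgroup U E.openNormalSubgroup : Subgroup U) := by
  ext u
  change toSubgroupImage U E u = 1 ↔
    (u : absoluteGaloisGroup F) ∈ (E.openNormalSubgroup : Subgroup (absoluteGaloisGroup F))
  rw [← restrictHom_eq_one_iff, ← coe_toSubgroupImage_apply, OneMemClass.coe_eq_one]

/-- **`U ⧸ (U_E ∩ U) ≃* H_E`** (first isomorphism theorem for `u ↦ u|_E`; Mathlib `QuotientGroup.liftEquiv`).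
[cite: SerreGaloisCohomology1997, I §2.2 Proposition 8] -/
def subgroupImageEquiv (U : Subgroup (absoluteGaloisGroup F)) (E : GalLayer F) :
    U ⧸ (DiscreteRep.traceOpenNormalSubgroup U E.openNormalSubgroup : Subgroup U) ≃* subgroupImage U E :=
  QuotientGroup.liftEquiv _ (toSubgroupImage_surjective U E) (ker_toSubgroupImage U E).symm

/-- `subgroupImageEquiv [u] = u|_E`. [cite: SerreGaloisCohomology1997, I §2.2 Proposition 8] -/
theorem subgroupImageEquiv_mk (U : Subgroup (absoluteGaloisGroup F)) (E : GalLayer F) (u : U) :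
    subgroupImageEquiv U E (QuotientGroup.mk u) = toSubgroupImage U E u := rfl

/-- `(subgroupImageEquiv [u] : Gal(E/F)) = u|_E`. [cite: SerreGaloisCohomology1997, I §2.2 Proposition 8] -/
theorem coe_subgroupImageEquiv_mk (U : Subgroup (absoluteGaloisGroup F)) (E : GalLayer F) (u : U) :
    ((subgroupImageEquiv U E (QuotientGroup.mk u) : subgroupImage U E) : E.1 ≃ₐ[F] E.1) = E.restrictHom u := rfl

/-- **`res : H_{E'} → H_E`** for `E ≤ E'` (restriction of `GalLayer.resHom h : Gal(E'/F) → Gal(E/F)` to the images of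
`U`; `(σ|_{E'})|_E = σ|_E`). [cite: SerreGaloisCohomology1997, I §2.2 Proposition 8] -/
def subgroupImageRes (U : Subgroup (absoluteGaloisGroup F)) {E E' : GalLayer F} (h : E ≤ E') :
    subgroupImage U E' →* subgroupImage U E :=
  ((resHom h).comp (subgroupImage U E').subtype).codRestrict _ fun τ => by
    obtain ⟨σ, hσ, hστ⟩ := Subgroup.mem_map.1 τ.2
    refine Subgroup.mem_map.2 ⟨σ, hσ, ?_⟩
    change E.restrictHom σ = resHom h (τ : E'.1 ≃ₐ[F] E'.1)
    rw [← hστ, resHom_restrictHom]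

/-- Formula. [cite: SerreGaloisCohomology1997, I §2.2 Proposition 8] -/
@[simp]
theorem coe_subgroupImageRes_apply (U : Subgroup (absoluteGaloisGroup F)) {E E' : GalLayer F} (h : E ≤ E')
    (τ : subgroupImage U E') :
    ((subgroupImageRes U h τ : subgroupImage U E) : E.1 ≃ₐ[F] E.1) = resHom h (τ : E'.1 ≃ₐ[F] E'.1) := rfl

/-- `res (u|_{E'}) = u|_E` on the images. [cite: SerreGaloisCohomology1997, I §2.2 Proposition 8] -/
theorem subgroupImageRes_toSubgroupImage (U : Subgroup (absoluteGaloisGroup F)) {E E' : GalLayer F} (h : E ≤ E')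
    (u : U) : subgroupImageRes U h (toSubgroupImage U E' u) = toSubgroupImage U E u :=
  Subtype.ext (resHom_restrictHom h (u : absoluteGaloisGroup F))

/-- `H_E ↪ Gal(E/F)` after `res : H_{E'} → H_E` is `res : Gal(E'/F) → Gal(E/F)` after `H_{E'} ↪ Gal(E'/F)`.
[cite: SerreGaloisCohomology1997, I §2.2 Proposition 8] -/
theorem subtype_comp_subgroupImageRes (U : Subgroup (absoluteGaloisGroup F)) {E E' : GalLayer F} (h : E ≤ E') :
    (subgroupImage U E).subtype.comp (subgroupImageRes U h) = (resHom h).comp (subgroupImage U E').subtype := rfl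

/-- `res ∘ subgroupImageEquiv_{E'} ∘ quotMap-compatibility`: `res_{E'E} ([u]_{E'} ↦ u|_{E'}) = ([u]_E ↦ u|_E) ∘ quotMap`
as homomorphisms `U ⧸ (U_{E'} ∩ U) → H_E`. [cite: SerreGaloisCohomology1997, I §2.2 Proposition 8] -/
theorem quotMap_comp_subgroupImageEquiv_symm_eq (U : Subgroup (absoluteGaloisGroup F)) {E E' : GalLayer F}
    (h : E ≤ E') :
    (DiscreteRep.quotMap
          (DiscreteRep.traceOpenNormalSubgroup U E.openNormalSubgroup : Subgroup U)
          (DiscreteRep.traceOpenNormalSubgroup U E'.openNormalSubgroup : Subgroup U)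
          (DiscreteRep.traceOpenNormalSubgroup_mono U (coe_openNormalSubgroup_le h))).comp
        (subgroupImageEquiv U E').symm.toMonoidHom =
      (subgroupImageEquiv U E).symm.toMonoidHom.comp (subgroupImageRes U h) := by
  refine MonoidHom.ext fun τ => ?_
  obtain ⟨u, rfl⟩ := toSubgroupImage_surjective U E' τ
  change DiscreteRep.quotMap _ _ (DiscreteRep.traceOpenNormalSubgroup_mono U (coe_openNormalSubgroup_le h))
      ((subgroupImageEquiv U E').symm (toSubgroupImage U E' u)) =
    (subgroupImageEquiv U E).symm (subgroupImageRes U h (toSubgroupImage U E' u))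
  rw [subgroupImageRes_toSubgroupImage, ← subgroupImageEquiv_mk, ← subgroupImageEquiv_mk,
    MulEquiv.symm_apply_apply, MulEquiv.symm_apply_apply]
  rfl

end GalLayer

end IdeleClassBar

open IdeleClassBar

namespace GalLayerData

variable {F : Type} [Field F] (D : GalLayerData F) (U : Subgroup (absoluteGaloisGroup F))

/-! ## §8. The relative layer `(Res_U lim S)^{U_E ∩ U} ≅ Res_{H_E} D.obj E` -/

/-- **Door-c4's layer object for the group `U`**: `(Res_U lim S)^{U_E ∩ U}` as a representation of `U ⧸ (U_E ∩ U)`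
(`(invariantsQuotFunctor ℤ (U_E ∩ U)).obj ((resD ℤ U).obj S.toD)`; an abbreviation, so that door-c4's `stepG` applies
verbatim). [cite: SerreGaloisCohomology1997, I §2.2 Proposition 8] -/
abbrev relLayerRep (E : GalLayer F) :
    Rep ℤ (U ⧸ (DiscreteRep.traceOpenNormalSubgroup U E.openNormalSubgroup : Subgroup U)) :=
  (DiscreteRep.invariantsQuotFunctor ℤ
      (DiscreteRep.traceOpenNormalSubgroup U E.openNormalSubgroup : Subgroup U)).obj
    ((DiscreteRep.resD ℤ U).obj D.toSystem.toD)

/-- The underlying vector of `[u] • z` in the relative layer is `u • z`. [cite: Harari2020, §13.1] -/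
theorem coe_relLayerRep_ρ_mk (E : GalLayer F) (u : U) (z : (D.relLayerRep U E).V) :
    (((D.relLayerRep U E).ρ (QuotientGroup.mk u) z).1 : D.toSystem.limit) =
      D.toSystem.rep (u : absoluteGaloisGroup F) (z.1 : D.toSystem.limit) := rfl

variable {U}

/-- **Same vectors as the layer `(lim S)^{U_E}`** (`U_E ≤ U`): `(Res_U lim S)^{U_E ∩ U} ≃ₗ[ℤ] (lim S)^{U_E}`, `z ↦ z`.
[cite: SerreGaloisCohomology1997, I §2.2 Proposition 8] -/
def relToLayer {E : GalLayer F} (hE : (E.openNormalSubgroup : Subgroup (absoluteGaloisGroup F)) ≤ U) :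
    letI := (D.relLayerRep U E).hV2
    letI := (D.layerRep E).hV2
    (D.relLayerRep U E).V ≃ₗ[ℤ] (D.layerRep E).V :=
  letI := (D.relLayerRep U E).hV2
  letI := (D.layerRep E).hV2
  { toFun := fun z => ⟨z.1, DiscreteRep.coe_traceLayer_mem_invariants U E.openNormalSubgroup D.toSystem.toD hE z⟩
    map_add' := fun _ _ => rfl
    map_smul' := fun _ _ => rfl
    invFun := fun z => ⟨z.1, DiscreteRep.mem_invariants_traceLayer U E.openNormalSubgroup D.toSystem.toD z.1 z.2⟩
    left_inv := fun _ => rfl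
    right_inv := fun _ => rfl }

/-- Formula: `relToLayer` is the identity on underlying vectors. [cite: SerreGaloisCohomology1997, I §2.2 Proposition 8] -/
@[simp]
theorem coe_relToLayer {E : GalLayer F} (hE : (E.openNormalSubgroup : Subgroup (absoluteGaloisGroup F)) ≤ U)
    (z : (D.relLayerRep U E).V) : ((D.relToLayer hE z).1 : D.toSystem.limit) = z.1 := rfl

/-- **The relative layer module: `(Res_U lim S)^{U_E ∩ U} ≃ₗ[ℤ] D.V E`** (`relToLayer`, then door-c5's `layerEquiv`);
the codomain is written as the module of `Res_{H_E} D.obj E` (the same type), so that Mathlib's `groupCohomology.mapIso`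
applies verbatim. [cite: SerreGaloisCohomology1997, I §2.2 Proposition 8][cite: Harari2020, §13.1] -/
def relLayerEquiv {E : GalLayer F} (hE : (E.openNormalSubgroup : Subgroup (absoluteGaloisGroup F)) ≤ U) :
    letI := (D.relLayerRep U E).hV2
    letI := (Rep.res (GalLayer.subgroupImage U E).subtype (D.obj E)).hV2
    (D.relLayerRep U E).V ≃ₗ[ℤ] (Rep.res (GalLayer.subgroupImage U E).subtype (D.obj E)).V :=
  letI := (D.relLayerRep U E).hV2
  letI := (Rep.res (GalLayer.subgroupImage U E).subtype (D.obj E)).hV2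
  letI := (D.layerRep E).hV2
  (D.relToLayer hE).trans (D.layerEquiv E)

/-- Formula: `relLayerEquiv z = layerEquiv (relToLayer z)`. [cite: Harari2020, §13.1] -/
theorem relLayerEquiv_apply {E : GalLayer F} (hE : (E.openNormalSubgroup : Subgroup (absoluteGaloisGroup F)) ≤ U)
    (z : (D.relLayerRep U E).V) : D.relLayerEquiv hE z = D.layerEquiv E (D.relToLayer hE z) := rfl

/-- `[relLayerEquiv z] = z` in `lim S`. [cite: Harari2020, §13.1] -/
theorem of_relLayerEquiv {E : GalLayer F} (hE : (E.openNormalSubgroup : Subgroup (absoluteGaloisGroup F)) ≤ U)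
    (z : (D.relLayerRep U E).V) : D.toSystem.of E (D.relLayerEquiv hE z) = (z.1 : D.toSystem.limit) := by
  rw [relLayerEquiv_apply, of_layerEquiv, coe_relToLayer]

/-- `relLayerEquiv z = x ↔ z = [x]`. [cite: Harari2020, §13.1] -/
theorem relLayerEquiv_eq_iff {E : GalLayer F} (hE : (E.openNormalSubgroup : Subgroup (absoluteGaloisGroup F)) ≤ U)
    (z : (D.relLayerRep U E).V) (x : D.V E) :
    D.relLayerEquiv hE z = x ↔ (z.1 : D.toSystem.limit) = D.toSystem.of E x := by
  rw [relLayerEquiv_apply, layerEquiv_eq_iff]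
  exact Iff.rfl

/-- **Equivariance**: `relLayerEquiv ([u] • z) = u|_E • relLayerEquiv z`. [cite: Harari2020, §13.1] -/
theorem relLayerEquiv_ρ_mk {E : GalLayer F} (hE : (E.openNormalSubgroup : Subgroup (absoluteGaloisGroup F)) ≤ U)
    (u : U) (z : (D.relLayerRep U E).V) :
    D.relLayerEquiv hE ((D.relLayerRep U E).ρ (QuotientGroup.mk u) z) =
      D.ρ E (E.restrictHom (u : absoluteGaloisGroup F)) (D.relLayerEquiv hE z) := by
  rw [relLayerEquiv_eq_iff, coe_relLayerRep_ρ_mk, ← D.of_relLayerEquiv hE z, GalLayerSystem.rep_of]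

/-- **`relLayerEquiv` intertwines the `U ⧸ (U_E ∩ U)`-action with the `H_E`-action on `D.obj E` along
`subgroupImageEquiv`** (stated with the coercion `↑` to a linear map, the form Mathlib's `groupCohomology.mapIso` consumes).
[cite: Harari2020, §13.1] -/
theorem relLayerEquiv_comm {E : GalLayer F} (hE : (E.openNormalSubgroup : Subgroup (absoluteGaloisGroup F)) ≤ U)
    (g : U ⧸ (DiscreteRep.traceOpenNormalSubgroup U E.openNormalSubgroup : Subgroup U)) :
    letI := (D.relLayerRep U E).hV2
    letI := (Rep.res (GalLayer.subgroupImage U E).subtype (D.obj E)).hV2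
    (D.relLayerEquiv hE : (D.relLayerRep U E).V →ₗ[ℤ] (Rep.res (GalLayer.subgroupImage U E).subtype (D.obj E)).V) ∘ₗ
        (D.relLayerRep U E).ρ g =
      (Rep.res (GalLayer.subgroupImage U E).subtype (D.obj E)).ρ (GalLayer.subgroupImageEquiv U E g) ∘ₗ
        (D.relLayerEquiv hE : (D.relLayerRep U E).V →ₗ[ℤ] (Rep.res (GalLayer.subgroupImage U E).subtype (D.obj E)).V) := by
  induction g using QuotientGroup.induction_on with
  | H u =>
    refine LinearMap.ext fun z => ?_
    change D.relLayerEquiv hE ((D.relLayerRep U E).ρ (QuotientGroup.mk u) z) =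
      D.ρ E ((GalLayer.subgroupImageEquiv U E (QuotientGroup.mk u) : GalLayer.subgroupImage U E) :
        E.1 ≃ₐ[F] E.1) (D.relLayerEquiv hE z)
    rw [relLayerEquiv_ρ_mk, GalLayer.coe_subgroupImageEquiv_mk]

/-- **The relative layers have the cohomology of the subgroups `H_E`:
`Hⁿ(U ⧸ (U_E ∩ U), (Res_U lim S)^{U_E ∩ U}) ≅ Hⁿ(H_E, Res_{H_E} D.obj E)`** (Mathlib `groupCohomology.mapIso` along
`subgroupImageEquiv`, `relLayerEquiv`). [cite: SerreGaloisCohomology1997, I §2.2 Proposition 8][cite: Harari2020, §4.3 (2)–(3)] -/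
def relLayerCohomologyIso {E : GalLayer F} (hE : (E.openNormalSubgroup : Subgroup (absoluteGaloisGroup F)) ≤ U)
    (n : ℕ) :
    groupCohomology (D.relLayerRep U E) n ≅
      groupCohomology (Rep.res (GalLayer.subgroupImage U E).subtype (D.obj E)) n :=
  -- the equivariance is proved in place (pointwise it is `relLayerEquiv_ρ_mk`), so that the instance paths of
  -- Mathlib's generic statement are the goal's and no global definitional unfolding is needed
  groupCohomology.mapIso (A := Rep.res (GalLayer.subgroupImage U E).subtype (D.obj E)) (B := D.relLayerRep U E)
    (GalLayer.subgroupImageEquiv U E) (D.relLayerEquiv hE)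
    (fun g => QuotientGroup.induction_on g fun u => LinearMap.ext fun z => by
      change D.relLayerEquiv hE ((D.relLayerRep U E).ρ (QuotientGroup.mk u) z) =
        D.ρ E ((GalLayer.subgroupImageEquiv U E (QuotientGroup.mk u) : GalLayer.subgroupImage U E) :
          E.1 ≃ₐ[F] E.1) (D.relLayerEquiv hE z)
      rw [relLayerEquiv_ρ_mk, GalLayer.coe_subgroupImageEquiv_mk])
    n

/-! ## §9. The transitions for the group `U` are the relative inflations -/

/-- The base change `D.base h` intertwines the actions of `τ ∈ H_{E'}` on `D.obj E` (through `res τ ∈ H_E`) and on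
`D.obj E'` (`E ≤ E'`; from `base_ρ`). [cite: CasselsFrohlichANT1967, Ch. VII §11.1] -/
theorem base_ρ_subgroupImageRes {E E' : GalLayer F} (h : E ≤ E') (τ : GalLayer.subgroupImage U E') (x : D.V E) :
    D.base h (D.ρ E ((GalLayer.subgroupImageRes U h τ : GalLayer.subgroupImage U E) : E.1 ≃ₐ[F] E.1) x) =
      D.ρ E' (τ : E'.1 ≃ₐ[F] E'.1) (D.base h x) := by
  obtain ⟨u, rfl⟩ := GalLayer.toSubgroupImage_surjective U E' τ
  rw [GalLayer.subgroupImageRes_toSubgroupImage, GalLayer.coe_toSubgroupImage_apply,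
    GalLayer.coe_toSubgroupImage_apply]
  exact D.base_ρ h (u : absoluteGaloisGroup F) x

/-- **The base change as a morphism `Res_{res} Res_{H_E} D.obj E ⟶ Res_{H_{E'}} D.obj E'`** of `H_{E'}`-modules
(`E ≤ E'`). [cite: CasselsFrohlichANT1967, Ch. VII §11.1] -/
def relBaseRepHom {E E' : GalLayer F} (h : E ≤ E') :
    Rep.res (GalLayer.subgroupImageRes U h) (Rep.res (GalLayer.subgroupImage U E).subtype (D.obj E)) ⟶
      Rep.res (GalLayer.subgroupImage U E').subtype (D.obj E') :=
  Rep.ofHom ⟨(D.base h).toIntLinearMap, fun τ => LinearMap.ext fun x => D.base_ρ_subgroupImageRes h τ x⟩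

/-- Formula: `relBaseRepHom` is `D.base` on vectors. [cite: CasselsFrohlichANT1967, Ch. VII §11.1] -/
theorem relBaseRepHom_hom_apply {E E' : GalLayer F} (h : E ≤ E') (x : D.V E) :
    (D.relBaseRepHom (U := U) h).hom x = D.base h x := rfl

variable (U) in
/-- **The relative inflation `Hⁿ(H_E, Res D.obj E) → Hⁿ(H_{E'}, Res D.obj E')`** (`E ≤ E'`; Mathlib
`groupCohomology.map (res : H_{E'} → H_E) (D.base h)`). [cite: CasselsFrohlichANT1967, Ch. VII §11.1] -/
def relInf {E E' : GalLayer F} (h : E ≤ E') (n : ℕ) :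
    groupCohomology (Rep.res (GalLayer.subgroupImage U E).subtype (D.obj E)) n ⟶
      groupCohomology (Rep.res (GalLayer.subgroupImage U E').subtype (D.obj E')) n :=
  groupCohomology.map (GalLayer.subgroupImageRes U h) (D.relBaseRepHom h) n

/-- **`res_{H_E} ≫ relInf = D.inf ≫ res_{H_{E'}}`**: the relative inflation is the inflation of the system restricted
to the subgroups (both composites are `Hⁿ` along `H_{E'} → Gal(E/F)` with underlying map `D.base h`).
[cite: CasselsFrohlichANT1967, Ch. VII §11.1] -/
theorem res_comp_relInf {E E' : GalLayer F} (h : E ≤ E') (n : ℕ) :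
    groupCohomology.map (GalLayer.subgroupImage U E).subtype
        (𝟙 (Rep.res (GalLayer.subgroupImage U E).subtype (D.obj E))) n ≫ D.relInf U h n =
      D.inf h n ≫ groupCohomology.map (GalLayer.subgroupImage U E').subtype
        (𝟙 (Rep.res (GalLayer.subgroupImage U E').subtype (D.obj E'))) n := by
  rw [relInf, inf, ← groupCohomology.map_comp, ← groupCohomology.map_comp]
  exact map_congr' (GalLayer.subtype_comp_subgroupImageRes U h) _ _ (fun _ => rfl) n

/-- **The inclusion `(Res_U lim S)^{U_E ∩ U} ⊆ (Res_U lim S)^{U_{E'} ∩ U}` is `D.base h`** under the `relLayerEquiv`s.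
[cite: Harari2020, §13.1] -/
theorem relLayerEquiv_invariantsStepIncl {E E' : GalLayer F}
    (hE : (E.openNormalSubgroup : Subgroup (absoluteGaloisGroup F)) ≤ U)
    (hE' : (E'.openNormalSubgroup : Subgroup (absoluteGaloisGroup F)) ≤ U) (h : E ≤ E')
    (z : (D.relLayerRep U E).V) :
    D.relLayerEquiv hE' ((DiscreteRep.invariantsStepIncl
        (DiscreteRep.traceOpenNormalSubgroup U E.openNormalSubgroup : Subgroup U)
        (DiscreteRep.traceOpenNormalSubgroup U E'.openNormalSubgroup : Subgroup U)
        (DiscreteRep.traceOpenNormalSubgroup_mono U (GalLayer.coe_openNormalSubgroup_le h))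
        ((DiscreteRep.resD ℤ U).obj D.toSystem.toD)).hom z) =
      D.base h (D.relLayerEquiv hE z) := by
  rw [relLayerEquiv_eq_iff, DiscreteRep.invariantsStepIncl_hom_apply_coe, GalLayerSystem.of_base]
  exact (D.of_relLayerEquiv hE z).symm

set_option maxHeartbeats 1600000 in
-- the two `groupCohomology.map` composites are compared through Mathlib's generic `map_comp` / the cell's
-- `map_congr'`; the definitional unfolding of the `ℤ`-instance paths (`Int.instSemiring` here vs the `CommRing ℤ`
-- path of door-c4's generic layer system) is what needs the heartbeats
/-- **`stepG ≫ iso_{E'} = iso_E ≫ relInf` for all `E ≤ E'` with `U_E ≤ U`**: door-c4's transition between the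
relative layers of the group `U` IS the relative inflation (both are `groupCohomology.map` along the same
homomorphism `H_{E'} → U ⧸ (U_E ∩ U)` with the same underlying map `z ↦ D.base h z`).
[cite: SerreGaloisCohomology1997, I §2.2 Proposition 8][cite: CasselsFrohlichANT1967, Ch. VII §11.1] -/
theorem stepG_comp_relLayerCohomologyIso {E E' : GalLayer F}
    (hE : (E.openNormalSubgroup : Subgroup (absoluteGaloisGroup F)) ≤ U)
    (hE' : (E'.openNormalSubgroup : Subgroup (absoluteGaloisGroup F)) ≤ U) (h : E ≤ E') (n : ℕ) :
    DiscreteRep.LayerColimit.stepG (DiscreteRep.traceOpenNormalSubgroup U E.openNormalSubgroup)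
        (DiscreteRep.traceOpenNormalSubgroup U E'.openNormalSubgroup)
        (DiscreteRep.traceOpenNormalSubgroup_mono U (GalLayer.coe_openNormalSubgroup_le h))
        ((DiscreteRep.resD ℤ U).obj D.toSystem.toD) n ≫ (D.relLayerCohomologyIso hE' n).hom =
      (D.relLayerCohomologyIso hE n).hom ≫ D.relInf U h n := by
  rw [relLayerCohomologyIso, relLayerCohomologyIso, groupCohomology.mapIso_hom, groupCohomology.mapIso_hom,
    relInf, ← groupCohomology.map_comp, ← groupCohomology.map_comp]
  refine map_congr' (GalLayer.quotMap_comp_subgroupImageEquiv_symm_eq U h) _ _ (fun z => ?_) n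
  exact (D.relLayerEquiv_invariantsStepIncl hE hE' h z).trans (D.relBaseRepHom_hom_apply h _).symm

/-- Elementwise form: `iso_{E'} (stepG c) = relInf (iso_E c)` for a class `c` of the relative layer at `E`.
[cite: SerreGaloisCohomology1997, I §2.2 Proposition 8] -/
theorem relLayerCohomologyIso_stepG {E E' : GalLayer F}
    (hE : (E.openNormalSubgroup : Subgroup (absoluteGaloisGroup F)) ≤ U)
    (hE' : (E'.openNormalSubgroup : Subgroup (absoluteGaloisGroup F)) ≤ U) (h : E ≤ E') (n : ℕ)
    (c : groupCohomology (D.relLayerRep U E) n) :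
    (D.relLayerCohomologyIso hE' n).hom (DiscreteRep.LayerColimit.stepG
        (DiscreteRep.traceOpenNormalSubgroup U E.openNormalSubgroup)
        (DiscreteRep.traceOpenNormalSubgroup U E'.openNormalSubgroup)
        (DiscreteRep.traceOpenNormalSubgroup_mono U (GalLayer.coe_openNormalSubgroup_le h))
        ((DiscreteRep.resD ℤ U).obj D.toSystem.toD) n c) =
      D.relInf U h n ((D.relLayerCohomologyIso hE n).hom c) := by
  rw [← CategoryTheory.comp_apply, ← CategoryTheory.comp_apply, stepG_comp_relLayerCohomologyIso]

end GalLayerData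

end Literature.NumberTheory.GaloisRepresentations

end
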